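import Mathlib.Combinatorics.SetFamily.Compression.Down
import Mathlib.Tactic
import HarnessLib
import HarnessLib.Audit.Tags
import Summits.CriticalPhenomena.PercolationContinuityZ3.Theorems.PercNearOneGluingNoHeavyLowerTailSahiRainbowTwoColourDeficitDefs

/-!
# The sparse residual is LOCAL, I: structure at a deficit point

Support file (seat `prim-masterthm-p1`, gen 42; `--supports stmt-CriticalPhenomena-4575`).  No `sorry`, standard axioms.
Blueprint `run/shared/lean/prim/prim-masterthm/FROM-prim-masterthm-p1-g42-*.md` (PROOFS §0–§1).

SETTING (`…SahiRainbowTwoColour{,Twins,Sparse,TwinPoint}`): `Z = X ⊔ Y ⊆ 2^G` complement-closed, `L = monoMeets X Y`,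
`D_y = bothLifts Z y` (doubled lower members at `y`), `twins_y = bothLifts L y`.  `SparseTwinPoint` asks, for a configuration
with `0 < #D_y < 6` at every point, for ONE point with `#D_y ≤ 2 · #twins_y`.  Call a point DEFICIT if `0 < #D_y < 6` and
`2 · #twins_y < #D_y`.  THIS GENERATION PROVES THAT NO THREE POINTS OF A CONFIGURATION CAN BE DEFICIT (for `#G ≥ 4`), which
settles `SparseTwinPoint` (file `…DeficitFinal`).  The whole argument is LOCAL: it only uses the doubled members at the two or
three points involved and the absence of non-empty twins there.

THIS FILE: the structure at ONE deficit point `y` (`local_structure`):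
* `NoTwin L y` — every colour `c ∌ y` with `insert y c` a colour is `∅`;
* `#D_y = 2` ⟹ an **S₁-point** (`S1At X Y G y P Q`): the two upper members `P ∈ X`, `Q ∈ Y` form a BICOLOURED bisection
  through `y` (`P ∩ Q = {y}`, `P ∪ Q = G`), `{y} ∉ L`, `NoTwin`;
* `#D_y = 4` ⟹ `{y} ∈ L`, `NoTwin`, and the four upper members are either a monochromatic `X`-bisection plus a monochromatic
  `Y`-bisection (**D-point**, `DAt`) or the bicoloured pair `{y}, G` plus a monochromatic bisection of the colour of `{y}`
  (**Q-point**, `Q3At`).  (FOUR-SET LEMMA: two complementary pairs of `G ∖ y`, 2-coloured so that no two same-coloured sets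
  meet, have this shape.)
HONEST FRAMING: unconditional structure lemmas; nothing here is specific to percolation. [this work]
-/

namespace Summit.CriticalPhenomena.PercolationContinuityZ3.Theorems.SahiColouredDaykin

open Finset
open scoped FinsetFamily

variable {α : Type*} [DecidableEq α]

/-! ### 6. The local structure at a deficit point -/

section Local

variable {G : Finset α} {K K' : Finset (Finset α)} {y : α}

/-- **Core of the classification at a point with two doubled pairs.**  `twins ⊆ {∅}`, `{y} ∈ L`; `d₁` has upper colour `K`;
`d₂` is a doubled member other than `d₁` and its complement.  Then the point is a D-point or a Q-point. [this work] -/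
theorem local_structure_core (hy : y ∈ G) (hZG : ∀ z ∈ K ∪ K', z ⊆ G) (hcc : ∀ z ∈ K ∪ K', G \ z ∈ K ∪ K')
    (htw : bothLifts (monoMeets K K') y ⊆ {∅}) (hsing : {y} ∈ monoMeets K K')
    {d₁ d₂ : Finset α} (hd₁ : d₁ ∈ upperClass (K ∪ K') K y) (hd₂ : d₂ ∈ bothLifts (K ∪ K') y) (h21 : d₂ ≠ d₁)
    (h21' : d₂ ≠ (G.erase y) \ d₁) :
    (∃ A A' B B', DAt K K' G y A A' B B') ∨ (∃ C C', Q3At K K' G y C C') ∨ (∃ C C', Q3At K' K G y C C') := by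
  have noTw : NoTwin (monoMeets K K') y := noTwin_of_bothLifts_subset htw
  set G' := G.erase y with hG'
  have hd₁D : d₁ ∈ bothLifts (K ∪ K') y := mem_bothLifts_of_mem_upperClass hd₁
  have sub₁ : d₁ ⊆ G' := subset_erase_of_mem_bothLifts hZG hd₁D
  have sub₂ : d₂ ⊆ G' := subset_erase_of_mem_bothLifts hZG hd₂
  have hd₁'D : G' \ d₁ ∈ bothLifts (K ∪ K') y := sdiff_mem_bothLifts hy hcc hd₁D
  have hd₂'D : G' \ d₂ ∈ bothLifts (K ∪ K') y := sdiff_mem_bothLifts hy hcc hd₂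
  have e₁ : G' \ (G' \ d₁) = d₁ := Finset.sdiff_sdiff_eq_self sub₁
  have e₂ : G' \ (G' \ d₂) = d₂ := Finset.sdiff_sdiff_eq_self sub₂
  have sub₁' : G' \ d₁ ⊆ G' := sdiff_subset
  have sub₂' : G' \ d₂ ⊆ G' := sdiff_subset
  have h2'1 : G' \ d₂ ≠ d₁ := fun h => h21' (by rw [← h, e₂])
  have h2'1' : G' \ d₂ ≠ G' \ d₁ := fun h => h21 (by rw [← e₂, h, e₁])
  -- a doubled member disjoint from both members of a complementary pair is empty
  have empty_of : ∀ {d e : Finset α}, d ⊆ G' → d ∩ e = ∅ → d ∩ (G' \ e) = ∅ → d = ∅ := by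
    intro d e hdG h1 h2
    apply eq_empty_of_forall_notMem; intro t ht
    by_cases hte : t ∈ e
    · have : t ∈ d ∩ e := mem_inter.2 ⟨ht, hte⟩
      rw [h1] at this; exact notMem_empty t this
    · have : t ∈ d ∩ (G' \ e) := mem_inter.2 ⟨ht, mem_sdiff.2 ⟨hdG ht, hte⟩⟩
      rw [h2] at this; exact notMem_empty t this
  -- a doubled member disjoint from `e` and whose complement is disjoint from `G' ∖ e` equals `G' ∖ e`
  have eq_of : ∀ {d e : Finset α}, d ⊆ G' → e ⊆ G' → d ∩ e = ∅ → (G' \ d) ∩ (G' \ e) = ∅ → d = G' \ e := by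
    intro d e hdG heG h1 h2
    ext t; simp only [mem_sdiff]
    constructor
    · intro ht
      refine ⟨hdG ht, fun hte => ?_⟩
      have : t ∈ d ∩ e := mem_inter.2 ⟨ht, hte⟩
      rw [h1] at this; exact notMem_empty t this
    · rintro ⟨htG, hte⟩
      by_contra htd
      have : t ∈ (G' \ d) ∩ (G' \ e) := mem_inter.2 ⟨mem_sdiff.2 ⟨htG, htd⟩, mem_sdiff.2 ⟨htG, hte⟩⟩
      rw [h2] at this; exact notMem_empty t this
  have GeK : G' = G.erase y := rfl
  -- Q-point builders
  have mkQ : ∀ {e : Finset α}, e ⊆ G' → e ∈ upperClass (K ∪ K') K y → G' \ e ∈ upperClass (K ∪ K') K y →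
      (∅ : Finset α) ∈ upperClass (K ∪ K') K y → G' ∈ upperClass (K ∪ K') K' y → ∃ C C', Q3At K K' G y C C' := by
    intro e heG he he' h0 hG1
    refine ⟨_, _, singleton_mem_of_upperClass h0, univ_mem_of_upperClass hy hG1, ?_, bisect_of_upperClass hy heG he he',
      hsing, noTw⟩
    exact (mem_bothLifts.1 (mem_bothLifts_of_mem_upperClass hG1)).2.1
  have mkQ' : ∀ {e : Finset α}, e ⊆ G' → e ∈ upperClass (K ∪ K') K' y → G' \ e ∈ upperClass (K ∪ K') K' y →
      (∅ : Finset α) ∈ upperClass (K ∪ K') K' y → G' ∈ upperClass (K ∪ K') K y → ∃ C C', Q3At K' K G y C C' := by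
    intro e heG he he' h0 hG1
    have he₂ : e ∈ upperClass (K' ∪ K) K' y := by rwa [union_comm K' K]
    have he₂' : (G.erase y) \ e ∈ upperClass (K' ∪ K) K' y := by rwa [union_comm K' K]
    refine ⟨_, _, singleton_mem_of_upperClass h0, univ_mem_of_upperClass hy hG1, ?_, bisect_of_upperClass hy heG he₂ he₂',
      ?_, ?_⟩
    · rw [union_comm K' K]; exact (mem_bothLifts.1 (mem_bothLifts_of_mem_upperClass hG1)).2.1
    · rw [monoMeets_comm]; exact hsing
    · rw [monoMeets_comm]; exact noTw
  -- case analysis on the upper colours of `G' ∖ d₁`, `d₂`, `G' ∖ d₂`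
  rcases mem_upperClass_or hd₁'D with h1'K | h1'K'
  · -- `{d₁, G' ∖ d₁}` is a `K`-bisection
    have bis₁ := bisect_of_upperClass hy sub₁ hd₁ h1'K
    rcases mem_upperClass_or hd₂ with h2K | h2K'
    · -- `d₂` meets neither `d₁` nor its complement: `d₂ = ∅`, and then `G' ∖ d₂ = G'` has colour `K'`
      have hd₂0 : d₂ = ∅ := empty_of sub₂ (inter_eq_empty_of_upperClass_left htw h2K hd₁ h21)
        (inter_eq_empty_of_upperClass_left htw h2K h1'K h21')
      rcases mem_upperClass_or hd₂'D with h2'K | h2'K'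
      · exfalso
        have := inter_eq_empty_of_upperClass_left htw h2'K hd₁ h2'1
        rw [hd₂0, sdiff_empty, inter_eq_right.2 sub₁] at this
        exact h21 (by rw [hd₂0, this])
      · right; left
        rw [hd₂0, sdiff_empty] at h2'K'
        exact mkQ sub₁ hd₁ h1'K (hd₂0 ▸ h2K) h2'K'
    · rcases mem_upperClass_or hd₂'D with h2'K | h2'K'
      · -- symmetric: `G' ∖ d₂ = ∅`
        have hd₂'0 : G' \ d₂ = ∅ := empty_of sub₂' (inter_eq_empty_of_upperClass_left htw h2'K hd₁ h2'1)
          (inter_eq_empty_of_upperClass_left htw h2'K h1'K h2'1')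
        have hd₂G : d₂ = G' := by rw [← e₂, hd₂'0, sdiff_empty]
        right; left
        exact mkQ sub₁ hd₁ h1'K (hd₂'0 ▸ h2'K) (hd₂G ▸ h2K')
      · -- D-point: `K`-bisection from `d₁`, `K'`-bisection from `d₂`
        left
        exact ⟨_, _, _, _, bis₁, bisect_of_upperClass hy sub₂ h2K' h2'K', hsing, noTw⟩
  · -- `d₁ ∈ K`-class, `G' ∖ d₁ ∈ K'`-class
    rcases mem_upperClass_or hd₂ with h2K | h2K'
    · rcases mem_upperClass_or hd₂'D with h2'K | h2'K'
      · -- `{d₂, G' ∖ d₂}` is a `K`-bisection avoiding `d₁`: `d₁ = ∅`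
        have h1 : d₁ ∩ d₂ = ∅ := inter_eq_empty_of_upperClass_left htw hd₁ h2K h21.symm
        have h2 : d₁ ∩ (G' \ d₂) = ∅ := inter_eq_empty_of_upperClass_left htw hd₁ h2'K h2'1.symm
        have hd₁0 : d₁ = ∅ := empty_of sub₁ h1 h2
        right; left
        refine mkQ sub₂ h2K h2'K (hd₁0 ▸ hd₁) ?_
        rwa [hd₁0, sdiff_empty] at h1'K'
      · -- `d₂ ⊆ G' ∖ d₁` and `G' ∖ d₂ ⊆ d₁`: forces `d₂ = G' ∖ d₁`
        exfalso
        have h1 : d₂ ∩ d₁ = ∅ := inter_eq_empty_of_upperClass_left htw h2K hd₁ h21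
        have h2 : (G' \ d₂) ∩ (G' \ d₁) = ∅ := inter_eq_empty_of_upperClass_right htw h2'K' h1'K' h2'1'
        exact h21' (eq_of sub₂ sub₁ h1 h2)
    · rcases mem_upperClass_or hd₂'D with h2'K | h2'K'
      · -- `G' ∖ d₂ ∩ d₁ = ∅` and `d₂ ∩ (G' ∖ d₁) = ∅`: forces `d₂ = d₁`
        exfalso
        have h1 : (G' \ d₂) ∩ d₁ = ∅ := inter_eq_empty_of_upperClass_left htw h2'K hd₁ h2'1
        have h2 : d₂ ∩ (G' \ d₁) = ∅ := inter_eq_empty_of_upperClass_right htw h2K' h1'K' h21'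
        have : G' \ d₂ = G' \ d₁ := by
          refine eq_of sub₂' sub₁ h1 ?_
          rwa [e₂]
        exact h2'1' this
      · -- `{d₂, G' ∖ d₂}` is a `K'`-bisection avoiding `G' ∖ d₁`: `G' ∖ d₁ = ∅`, `d₁ = G'`
        have h1 : (G' \ d₁) ∩ d₂ = ∅ := inter_eq_empty_of_upperClass_right htw h1'K' h2K' h21'.symm
        have h2 : (G' \ d₁) ∩ (G' \ d₂) = ∅ := inter_eq_empty_of_upperClass_right htw h1'K' h2'K' h2'1'.symm
        have hd₁'0 : G' \ d₁ = ∅ := empty_of sub₁' h1 h2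
        have hd₁G : d₁ = G' := by rw [← e₁, hd₁'0, sdiff_empty]
        right; right
        exact mkQ' sub₂ h2K' h2'K' (hd₁'0 ▸ h1'K') (hd₁G ▸ hd₁)

/-- **LOCAL STRUCTURE AT A DEFICIT POINT.**  If `0 < #D_y < 6` and `2 · #twins_y < #D_y` then `y` is an S₁-point, a
D-point, or a Q-point (for one of the two orientations of the colour classes). [this work] -/
theorem local_structure {X Y : Finset (Finset α)} (hy : y ∈ G) (hG : (G.erase y).Nonempty)
    (hZG : ∀ z ∈ X ∪ Y, z ⊆ G) (hcc : ∀ z ∈ X ∪ Y, G \ z ∈ X ∪ Y) (hXY : Disjoint X Y)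
    (hpos : 0 < #(bothLifts (X ∪ Y) y)) (hlt : #(bothLifts (X ∪ Y) y) < 6)
    (hdef : 2 * #(bothLifts (monoMeets X Y) y) < #(bothLifts (X ∪ Y) y)) :
    (∃ P Q, S1At X Y G y P Q) ∨ (∃ A A' B B', DAt X Y G y A A' B B') ∨
      (∃ C C', Q3At X Y G y C C') ∨ (∃ C C', Q3At Y X G y C C') := by
  obtain ⟨U, hU⟩ := even_card_bothLifts hy hZG hcc hXY hG
  obtain ⟨d₁, hd₁⟩ := card_pos.1 hpos
  have sub₁ : d₁ ⊆ (G.erase y) := subset_erase_of_mem_bothLifts hZG hd₁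
  have hd₁' : (G.erase y) \ d₁ ∈ bothLifts (X ∪ Y) y := sdiff_mem_bothLifts hy hcc hd₁
  have ne₁ : d₁ ≠ (G.erase y) \ d₁ := by
    intro e
    obtain ⟨t, ht⟩ := hG
    by_cases htd : t ∈ d₁
    · have := htd; rw [e] at this; exact (mem_sdiff.1 this).2 htd
    · have : t ∈ (G.erase y) \ d₁ := mem_sdiff.2 ⟨ht, htd⟩
      rw [← e] at this; exact htd this
  by_cases h2 : #(bothLifts (X ∪ Y) y) = 2
  · -- one doubled pair: S₁-point
    have hTW0 : (bothLifts (monoMeets X Y) y) = ∅ := by rw [← card_eq_zero]; omega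
    have htw : (bothLifts (monoMeets X Y) y) ⊆ {∅} := by rw [hTW0]; exact empty_subset _
    have hsing : {y} ∉ monoMeets X Y := by
      intro h
      have : (∅ : Finset α) ∈ (bothLifts (monoMeets X Y) y) :=
        mem_bothLifts.2 ⟨notMem_empty y, empty_mem_monoMeets X Y, by rwa [insert_empty]⟩
      rw [hTW0] at this; exact notMem_empty _ this
    have build : ∀ {e : Finset α}, e ⊆ (G.erase y) → e ∈ upperClass (X ∪ Y) X y → (G.erase y) \ e ∈ upperClass (X ∪ Y) Y y →
        S1At X Y G y (insert y e) (insert y ((G.erase y) \ e)) := by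
      intro e heG he he'
      obtain ⟨heD, heX⟩ := mem_filter.1 he
      obtain ⟨he'D, he'Y⟩ := mem_filter.1 he'
      obtain ⟨hye, heZ, -⟩ := mem_bothLifts.1 heD
      obtain ⟨hye', he'Z, -⟩ := mem_bothLifts.1 he'D
      refine ⟨heX, he'Y, mem_insert_self _ _, mem_insert_self _ _, ?_, ?_, ?_, ?_, hsing, noTwin_of_bothLifts_subset htw⟩
      · rw [← insert_inter_distrib, inter_sdiff_self, insert_empty]
      · rw [← insert_union_distrib, union_sdiff_of_subset heG, insert_erase hy]
      · rw [erase_insert hye]; exact heZ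
      · rw [erase_insert hye']; exact he'Z
    left
    rcases mem_upperClass_or hd₁ with h1X | h1Y <;> rcases mem_upperClass_or hd₁' with h1'X | h1'Y
    · exfalso
      have := inter_eq_empty_of_upperClass_left htw h1X h1'X ne₁
      have h0 : (∅ : Finset α) ∈ (bothLifts (monoMeets X Y) y) := by
        rw [← this]; exact pairMeets_upperClass_subset_twins X Y y (inter_mem_pairMeets h1X h1'X ne₁)
      rw [hTW0] at h0; exact notMem_empty _ h0
    · exact ⟨_, _, build sub₁ h1X h1'Y⟩
    · have e₁ : (G.erase y) \ ((G.erase y) \ d₁) = d₁ := Finset.sdiff_sdiff_eq_self sub₁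
      refine ⟨_, _, build (e := (G.erase y) \ d₁) sdiff_subset h1'X ?_⟩
      rw [e₁]; exact h1Y
    · exfalso
      have h0 : (∅ : Finset α) ∈ (bothLifts (monoMeets X Y) y) := by
        rw [← inter_sdiff_self d₁ (G.erase y)]
        exact pairMeets_upperClass_union_subset_twins X Y y (mem_union_right _ (inter_mem_pairMeets h1Y h1'Y ne₁))
      rw [hTW0] at h0; exact notMem_empty _ h0
  · -- two doubled pairs
    have h4 : #(bothLifts (X ∪ Y) y) = 4 := by omega
    have htw1 : #(bothLifts (monoMeets X Y) y) ≤ 1 := by omega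
    -- a second doubled pair
    have hcard : 0 < #(((bothLifts (X ∪ Y) y).erase d₁).erase ((G.erase y) \ d₁)) := by
      rw [card_erase_of_mem (mem_erase.2 ⟨ne₁.symm, hd₁'⟩), card_erase_of_mem hd₁]; omega
    obtain ⟨d₂, hd₂⟩ := card_pos.1 hcard
    simp only [mem_erase] at hd₂
    obtain ⟨h21', h21, hd₂D⟩ := hd₂
    have sub₂ : d₂ ⊆ (G.erase y) := subset_erase_of_mem_bothLifts hZG hd₂D
    have hd₂' : (G.erase y) \ d₂ ∈ bothLifts (X ∪ Y) y := sdiff_mem_bothLifts hy hcc hd₂D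
    have e₁ : (G.erase y) \ ((G.erase y) \ d₁) = d₁ := Finset.sdiff_sdiff_eq_self sub₁
    have e₂ : (G.erase y) \ ((G.erase y) \ d₂) = d₂ := Finset.sdiff_sdiff_eq_self sub₂
    -- FOUR-SET LEMMA: some upper-monochromatic pair meet is `∅`
    set PM := pairMeets (upperClass (X ∪ Y) X y) ∪ pairMeets (upperClass (X ∪ Y) Y y) with hPM
    have hPMtw : PM ⊆ (bothLifts (monoMeets X Y) y) := pairMeets_upperClass_union_subset_twins X Y y
    have cls : ∀ {d : Finset α}, d ∈ bothLifts (X ∪ Y) y → (d ∈ upperClass (X ∪ Y) Y y ↔ d ∉ upperClass (X ∪ Y) X y) := by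
      intro d hd
      constructor
      · intro h h'; exact disjoint_left.1 (disjoint_upperClass hXY y) h' h
      · intro h; rcases mem_upperClass_or hd with h' | h'
        · exact absurd h' h
        · exact h'
    have pm_of : ∀ {d e : Finset α}, d ∈ bothLifts (X ∪ Y) y → e ∈ bothLifts (X ∪ Y) y → d ≠ e →
        (d ∈ upperClass (X ∪ Y) X y ↔ e ∈ upperClass (X ∪ Y) X y) → d ∩ e ∈ PM := by
      intro d e hd he hde hiff
      by_cases h : d ∈ upperClass (X ∪ Y) X y
      · exact mem_union_left _ (inter_mem_pairMeets h (hiff.1 h) hde)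
      · exact mem_union_right _ (inter_mem_pairMeets ((cls hd).2 h) ((cls he).2 (fun h' => h (hiff.2 h'))) hde)
    have h0 : (∅ : Finset α) ∈ PM := by
      by_contra h0
      -- complementary members have different classes
      have diff : ∀ {d : Finset α}, d ∈ bothLifts (X ∪ Y) y → d ⊆ (G.erase y) →
          ¬ (d ∈ upperClass (X ∪ Y) X y ↔ (G.erase y) \ d ∈ upperClass (X ∪ Y) X y) := by
        intro d hd hdG hiff
        have hne : d ≠ (G.erase y) \ d := by
          intro e
          have : d ∩ ((G.erase y) \ d) = d := by rw [← e, inter_self]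
          rw [inter_sdiff_self] at this
          -- then `d = ∅` and `(G.erase y) = ∅`
          have hG0 : (G.erase y) = ∅ := by rw [← sdiff_empty (s := (G.erase y)), this, ← e, ← this]
          exact hG.ne_empty hG0
        have := pm_of hd (sdiff_mem_bothLifts hy hcc hd) hne hiff
        rw [inter_sdiff_self] at this; exact h0 this
      have c1 := diff hd₁ sub₁
      have c2 := diff hd₂D sub₂
      -- choose `e ∈ {d₂, (G.erase y) ∖ d₂}` with the class of `d₁`
      have key : ∃ e, e ∈ bothLifts (X ∪ Y) y ∧ (G.erase y) \ e ∈ bothLifts (X ∪ Y) y ∧ e ⊆ (G.erase y) ∧ e ≠ d₁ ∧ (G.erase y) \ e ≠ (G.erase y) \ d₁ ∧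
          (d₁ ∈ upperClass (X ∪ Y) X y ↔ e ∈ upperClass (X ∪ Y) X y) := by
        by_cases hiff : (d₁ ∈ upperClass (X ∪ Y) X y ↔ d₂ ∈ upperClass (X ∪ Y) X y)
        · exact ⟨d₂, hd₂D, hd₂', sub₂, h21, fun h => h21 (by rw [← e₂, h, e₁]), hiff⟩
        · refine ⟨(G.erase y) \ d₂, hd₂', by rw [e₂]; exact hd₂D, sdiff_subset, fun h => h21' (by rw [← h, e₂]),
            by rw [e₂]; exact h21', iff_of_not_iff hiff c2⟩
      obtain ⟨e, heD, he'D, heG, hne, hne', hiff⟩ := key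
      have m1 : d₁ ∩ e ∈ PM := pm_of hd₁ heD hne.symm hiff
      have m2 : ((G.erase y) \ d₁) ∩ ((G.erase y) \ e) ∈ PM := by
        exact pm_of hd₁' he'D hne'.symm (iff_of_iff_of_not_iff hiff c1 (diff heD heG))
      have hm1 : d₁ ∩ e ≠ ∅ := fun h => h0 (h ▸ m1)
      have hm12 : d₁ ∩ e ≠ ((G.erase y) \ d₁) ∩ ((G.erase y) \ e) := by
        intro h
        apply hm1
        apply eq_empty_of_forall_notMem; intro t ht
        have ht' := ht; rw [h] at ht'
        exact (mem_sdiff.1 (mem_inter.1 ht').1).2 (mem_inter.1 ht).1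
      have : 2 ≤ #(bothLifts (monoMeets X Y) y) := by
        have hsub : {d₁ ∩ e, ((G.erase y) \ d₁) ∩ ((G.erase y) \ e)} ⊆ (bothLifts (monoMeets X Y) y) :=
          insert_subset (hPMtw m1) (singleton_subset_iff.2 (hPMtw m2))
        have := card_le_card hsub
        rwa [card_pair hm12] at this
      omega
    have h0tw : (∅ : Finset α) ∈ (bothLifts (monoMeets X Y) y) := hPMtw h0
    have htw : (bothLifts (monoMeets X Y) y) ⊆ {∅} := by
      intro c hc
      exact mem_singleton.2 ((card_le_one.1 htw1) c hc ∅ h0tw)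
    have hsing : {y} ∈ monoMeets X Y := by
      have := (mem_bothLifts.1 h0tw).2.2; rwa [insert_empty] at this
    right
    rcases mem_upperClass_or hd₁ with h1X | h1Y
    · exact local_structure_core hy hZG hcc htw hsing h1X hd₂D h21 h21'
    · have hZG₂ : ∀ z ∈ Y ∪ X, z ⊆ G := by rw [union_comm]; exact hZG
      have hcc' : ∀ z ∈ Y ∪ X, G \ z ∈ Y ∪ X := by rw [union_comm]; exact hcc
      have htw' : bothLifts (monoMeets Y X) y ⊆ {∅} := by rw [monoMeets_comm]; exact htw
      have hsing' : {y} ∈ monoMeets Y X := by rw [monoMeets_comm]; exact hsing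
      have h1Y' : d₁ ∈ upperClass (Y ∪ X) Y y := by rw [union_comm]; exact h1Y
      have hd₂D' : d₂ ∈ bothLifts (Y ∪ X) y := by rw [union_comm]; exact hd₂D
      rcases local_structure_core hy hZG₂ hcc' htw' hsing' h1Y' hd₂D' h21 h21' with ⟨A, A', B, B', h⟩ | h | h
      · exact Or.inl ⟨B, B', A, A', h.swap⟩
      · exact Or.inr (Or.inr h)
      · exact Or.inr (Or.inl h)

end Local

end Summit.CriticalPhenomena.PercolationContinuityZ3.Theorems.SahiColouredDaykin
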